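import Summits.Ventures.YMGap.RobustBall.LocalSourceScreeningSRows
import HarnessLib

/-!
# Venture YMGap, track ROBUST-BALL (Y2) — the TIER-2 SCREENING CURRENCY `LocalScreeningOnBallZdS`: one screening rate and one
# constant for every member of the weighted infinite-range ball, every source and every pair of DLR states

HONEST FRAMING. WHAT THIS IS: a venture file (cell `pub-ymgap`, track Y2 ROBUST-BALL, seat rb-p1): the tier-2 twin of
`LocalScreeningOnBall.lean`, typing the conclusion of `LocalSourceScreeningS[Rows].lean` as a currency in the shape of
`UniformMassGapOnBallZdS d N β a Λ t m A`:

  `LocalScreeningOnBallZdS d N β a Λ t m A` := for EVERY member `W ∈ MemBallZdS a Λ t` (INFINITE range), EVERY continuous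
  link-summable source `V` (ANY strength; summable one-link oscillation witnesses with per-link loads `≤ B`, `= 0` off the
  finite link set `S`), every DLR state `μ` of `W` at 't Hooft coupling `β`, EVERY DLR state `ν` of `W + V`, every Lipschitz
  cylinder `F` (`Λ_F`, `K_F`): `|∫ F dμ − ∫ F dν| ≤ A · min(B,4) · e^{−m·d(Λ_F,S)} · #Λ_F · K_F`.

Nothing is asserted by the definition.  Bridges: `su2_localScreeningOnBallZdS_dim4` (RATE = WEIGHT `t`, `A = (√2/2)/(1−ρ)`,
`ρ = 6|β_W| e^{a} e^{t} + e^{a/2} √(2/3) Λ < 1`), `suN_localScreeningOnBallZdS_bakryEmery` (every `N ≥ 2`, every `d ≥ 1`),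
the all-`N` cell `suN_localScreeningOnBallZdS_1_64` (`m = log(6/5)`, `A = 50√N`), monotonicity `LocalScreeningOnBallZdS.mono`.
WHAT THIS IS NOT: `m` is a one-sided Dobrushin-comparison screening rate; lattice strong coupling only, nothing about the
continuum limit or a Clay-sense mass gap.
-/

noncomputable section

open MeasureTheory Function Finset ProbabilityTheory Real
open scoped NNReal
open Literature.Probability.LatticeModels
open Literature.Probability.LatticeModels.DobrushinMetric
open Literature.MathematicalPhysics.QuantumLattice
open Literature.MathematicalPhysics.QuantumFieldTheory hiding ZdEdge

namespace Summit.Ventures.YMGap.RobustBall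

variable {d N : ℕ}

variable (d N) in
/-- **THE TIER-2 SCREENING CURRENCY** — local sources are screened uniformly on the weighted `ℤ^d` ball `MemBallZdS a Λ t` with rate
`m` and constant `A`: for every member `W`, every continuous link-summable source `V` (majorant `BV`) with summable one-link
oscillation witnesses whose per-link loads are `≤ B` and vanish off the finite link set `S`, every DLR `μ` of `W` at 't Hooft
coupling `β`, every DLR `ν` of `W + V`, every Lipschitz cylinder `F` (`Λ_F`, `K_F`):
`|∫ F dμ − ∫ F dν| ≤ A · min(B,4) · e^{−m·d(Λ_F,S)} · #Λ_F · K_F`.  Nothing is asserted by the definition. -/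
def LocalScreeningOnBallZdS (β a Λ t m A : ℝ) : Prop :=
  ∀ (W : Potential (ZdEdge d) (Matrix.specialUnitaryGroup (Fin N) ℂ)), MemBallZdS a Λ t W →
  ∀ (V : Potential (ZdEdge d) (Matrix.specialUnitaryGroup (Fin N) ℂ)) (BV : Finset (ZdEdge d) → ℝ), IsLinkSummable V BV →
    (∀ X, Continuous (V X)) → (∀ X, DependsOn (V X) (↑X : Set (ZdEdge d))) →
  ∀ (oscV : Finset (ZdEdge d) → ZdEdge d → ℝ), (∀ X, Dobrushin.IsOscBound (V X) (oscV X)) →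
    (∀ e, Summable fun X : Finset (ZdEdge d) => (if e ∈ X then oscV X e else 0)) →
  ∀ (B : ℝ) (S : Finset (ZdEdge d)), (∀ e, ∑' X : Finset (ZdEdge d), (if e ∈ X then oscV X e else 0) ≤ B) →
    (∀ e, e ∉ S → ∑' X : Finset (ZdEdge d), (if e ∈ X then oscV X e else 0) ≤ 0) →
  ∀ μ ∈ perturbedGibbsMeasuresS (d := d) (fundamentalRep (Fin N)) (N * β) W,
  ∀ ν ∈ perturbedGibbsMeasuresS (d := d) (fundamentalRep (Fin N)) (N * β) (W + V),
  ∀ (F : LGConfig d (Matrix.specialUnitaryGroup (Fin N) ℂ) → ℝ) (ΛF : Finset (ZdEdge d)) (KF : ℝ≥0),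
    IsLipschitzCylinder (fundamentalRep (Fin N)) F ΛF KF →
      |(∫ σ, F σ ∂μ) - ∫ σ, F σ ∂ν| ≤ A * min B 4 * exp (-m * setDistEdges ΛF S) * (ΛF.card * KF)

/-- **Monotonicity**: a smaller rate and a larger constant are implied. -/
theorem LocalScreeningOnBallZdS.mono {β a Λ t m A m' A' : ℝ} (h : LocalScreeningOnBallZdS d N β a Λ t m A)
    (hm : m' ≤ m) (hA : A ≤ A') (hA0 : 0 ≤ A) : LocalScreeningOnBallZdS d N β a Λ t m' A' := by
  intro W hmem V BV hV hVc hVdep oscV hoscV hoscVs B S hB hS μ hμ ν hν F ΛF KF hF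
  have key := h W hmem V BV hV hVc hVdep oscV hoscV hoscVs B S hB hS μ hμ ν hν F ΛF KF hF
  rcases ΛF.eq_empty_or_nonempty with hΛ | ⟨e, _⟩
  · subst hΛ
    simpa using key
  refine key.trans ?_
  have hB0 : 0 ≤ min B 4 :=
    le_min (le_trans (tsum_nonneg fun X => by split_ifs; exacts [(hoscV X).nonneg e, le_rfl]) (hB e)) (by norm_num)
  have hexp : exp (-m * setDistEdges ΛF S) ≤ exp (-m' * setDistEdges ΛF S) :=
    exp_le_exp.2 (by nlinarith [setDistEdges_nonneg ΛF S])
  have hΛK : (0 : ℝ) ≤ ΛF.card * KF := by positivity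
  have hA'B : 0 ≤ A' * min B 4 := mul_nonneg (hA0.trans hA) hB0
  gcongr

/-- **`SU(2)`, `ℤ⁴`, RATE = WEIGHT, HYPOTHESIS-FREE**: `0 ≤ t`, `6|β_W| e^{a} e^{t} + e^{a/2} √(2/3) Λ < 1 ⇒
LocalScreeningOnBallZdS 4 2 (β_W/4) a Λ t t ((√2/2)/(1 − ρ))`, `ρ = 6|β_W| e^{a} e^{t} + e^{a/2} √(2/3) Λ`. -/
theorem su2_localScreeningOnBallZdS_dim4 {βW a Λ t : ℝ} (ht : 0 ≤ t)
    (hρ : 6 * |βW| * (exp a * exp t) + exp (a / 2) * Real.sqrt (2 / 3) * Λ < 1) :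
    LocalScreeningOnBallZdS 4 2 (βW / 4) a Λ t t
      (Real.sqrt 2 / 2 / (1 - (6 * |βW| * (exp a * exp t) + exp (a / 2) * Real.sqrt (2 / 3) * Λ))) := by
  intro W hmem V BV hV hVc hVdep oscV hoscV hoscVs B S hB hS μ hμ ν hν F ΛF KF hF
  have key := su2_localScreeningS_dim4 ht hρ hmem hV hVc hVdep hoscV hoscVs (bV := fun e =>
    ∑' X : Finset (ZdEdge 4), (if e ∈ X then oscV X e else 0)) (fun e => le_rfl) hB hS (μ := μ) (ν := ν)
    (by simpa using hμ) (by simpa using hν) hF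
  refine key.trans (le_of_eq ?_)
  have h1 : (0 : ℝ) < 1 - (6 * |βW| * (exp a * exp t) + exp (a / 2) * Real.sqrt (2 / 3) * Λ) := sub_pos.2 hρ
  field_simp

/-- **EVERY `N ≥ 2`, EVERY `d ≥ 1`, HYPOTHESIS-FREE** (Bakry–Émery pair, `b = 2(d−1)|β| < 1/2`, `t ≥ 0`):
`ρ := 6(d−1)|β| e^{a} e^{t}/(1/2 − b) + e^{a/2} Λ/√(N(1/2 − b)) < 1 ⇒ LocalScreeningOnBallZdS d N β a Λ t t ((√N/2)/(1 − ρ))`. -/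
theorem suN_localScreeningOnBallZdS_bakryEmery (hd : 1 ≤ d) (hN : 2 ≤ N) {β a Λ t : ℝ} (ht : 0 ≤ t)
    (hb : |β| * (2 * ((d : ℝ) - 1)) < 1 / 2)
    (hρ : 6 * ((d : ℝ) - 1) * |β| * (exp a * exp t) / (1 / 2 - |β| * (2 * ((d : ℝ) - 1))) +
      exp (a / 2) * Λ / Real.sqrt ((N : ℝ) * (1 / 2 - |β| * (2 * ((d : ℝ) - 1)))) < 1) :
    LocalScreeningOnBallZdS d N β a Λ t t
      (Real.sqrt N / 2 / (1 - (6 * ((d : ℝ) - 1) * |β| * (exp a * exp t) / (1 / 2 - |β| * (2 * ((d : ℝ) - 1))) +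
        exp (a / 2) * Λ / Real.sqrt ((N : ℝ) * (1 / 2 - |β| * (2 * ((d : ℝ) - 1))))))) := by
  intro W hmem V BV hV hVc hVdep oscV hoscV hoscVs B S hB hS μ hμ ν hν F ΛF KF hF
  have key := suN_localScreeningS_bakryEmery hd hN ht hb hρ hmem hV hVc hVdep hoscV hoscVs (bV := fun e =>
    ∑' X : Finset (ZdEdge d), (if e ∈ X then oscV X e else 0)) (fun e => le_rfl) hB hS hμ hν hF
  refine key.trans (le_of_eq ?_)
  have h1 : (0 : ℝ) < 1 - (6 * ((d : ℝ) - 1) * |β| * (exp a * exp t) / (1 / 2 - |β| * (2 * ((d : ℝ) - 1))) +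
      exp (a / 2) * Λ / Real.sqrt ((N : ℝ) * (1 / 2 - |β| * (2 * ((d : ℝ) - 1))))) := sub_pos.2 hρ
  field_simp

/-- **ALL `N ≥ 2` AT ONCE, 't Hooft `1/64`, ball `(1/20, 1/10)` at weight `log(6/5)`**: screening at rate `log(6/5)` with constant
`50√N`: `LocalScreeningOnBallZdS 4 N (1/64) (1/20) (1/10) (log(6/5)) (log(6/5)) (50√N)`. -/
theorem suN_localScreeningOnBallZdS_1_64 {N : ℕ} (hN : 2 ≤ N) :
    LocalScreeningOnBallZdS 4 N (1 / 64) (1 / 20) (1 / 10) (Real.log (6 / 5)) (Real.log (6 / 5)) (50 * Real.sqrt N) := by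
  intro W hmem V BV hV hVc hVdep oscV hoscV hoscVs B S hB hS μ hμ ν hν F ΛF KF hF
  have key := suN_localScreeningS_1_64 hN hmem hV hVc hVdep hoscV hoscVs (bV := fun e =>
    ∑' X : Finset (ZdEdge 4), (if e ∈ X then oscV X e else 0)) (fun e => le_rfl) hB hS hμ hν hF
  simpa only [mul_assoc, mul_comm, mul_left_comm] using key

end Summit.Ventures.YMGap.RobustBall

end
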